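import Mathlib

/-!
Triage r1-1, crux stmt-QuantumFields-11685 (ShellRigidity), card `null-family-sign-test`:
its First lemma `P4P6NullIndefinite` (IdeatorSketch3.lean, copied VERBATIM below) is true and
closes by elementary complex arithmetic — i.e. the First lemma is (correct but) trivial; the card's
load-bearing content is the inversion/dominance/order-count chain, not this lemma.
-/

namespace TriageR11

/-- verbatim copy of `Summit.QuantumFields.YangMills.Cruxes.ShellRigidity.Ideator3.P4P6NullIndefinite` -/
def P4P6NullIndefinite : Prop :=
  let s : ℂ := (Real.sqrt 2 : ℂ)⁻¹
  ((s * (Complex.I + 1)) ^ 4 + (s * (Complex.I - 1)) ^ 4).re < 0 ∧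
  0 < ((s * Complex.I) ^ 4 + (s * Complex.I) ^ 4 + (1 : ℂ) ^ 4).re ∧
  0 < ((s * Complex.I) ^ 6 + (s * Complex.I) ^ 6 + (1 : ℂ) ^ 6).re ∧
  (Complex.I ^ 6 + (s : ℂ) ^ 6 + (s : ℂ) ^ 6).re < 0

open Complex in
theorem p4p6NullIndefinite : P4P6NullIndefinite := by
  -- s² = 1/2 as a complex number
  have h2 : ((Real.sqrt 2 : ℝ) : ℂ) ^ 2 = 2 := by
    rw [← Complex.ofReal_pow, Real.sq_sqrt (by norm_num : (0:ℝ) ≤ 2)]; norm_num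
  set s : ℂ := ((Real.sqrt 2 : ℝ) : ℂ)⁻¹ with hs
  have hs2 : s ^ 2 = 1 / 2 := by rw [hs, inv_pow, h2]; norm_num
  have hs4 : s ^ 4 = 1 / 4 := by
    rw [show s ^ 4 = (s ^ 2) ^ 2 by ring, hs2]; norm_num
  have hs6 : s ^ 6 = 1 / 8 := by
    rw [show s ^ 6 = (s ^ 2) ^ 3 by ring, hs2]; norm_num
  have hI2 : Complex.I ^ 2 = -1 := Complex.I_sq
  have hI4 : Complex.I ^ 4 = 1 := by
    rw [show Complex.I ^ 4 = (Complex.I ^ 2) ^ 2 by ring, hI2]; norm_num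
  have hI6 : Complex.I ^ 6 = -1 := by
    rw [show Complex.I ^ 6 = (Complex.I ^ 2) ^ 3 by ring, hI2]; norm_num
  -- the four evaluations
  have e1 : (s * (Complex.I + 1)) ^ 4 = -1 := by
    have h' : (s * (Complex.I + 1)) ^ 2 = Complex.I := by
      have : (s * (Complex.I + 1)) ^ 2 = s ^ 2 * (Complex.I ^ 2 + 2 * Complex.I + 1) := by ring
      rw [this, hs2, hI2]; ring
    rw [show (s * (Complex.I + 1)) ^ 4 = ((s * (Complex.I + 1)) ^ 2) ^ 2 by ring, h', hI2]
  have e2 : (s * (Complex.I - 1)) ^ 4 = -1 := by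
    have h' : (s * (Complex.I - 1)) ^ 2 = -Complex.I := by
      have : (s * (Complex.I - 1)) ^ 2 = s ^ 2 * (Complex.I ^ 2 - 2 * Complex.I + 1) := by ring
      rw [this, hs2, hI2]; ring
    rw [show (s * (Complex.I - 1)) ^ 4 = ((s * (Complex.I - 1)) ^ 2) ^ 2 by ring, h']
    rw [show (-Complex.I) ^ 2 = Complex.I ^ 2 by ring, hI2]
  have e3 : (s * Complex.I) ^ 4 = 1 / 4 := by rw [mul_pow, hs4, hI4]; ring
  have e4 : (s * Complex.I) ^ 6 = -(1 / 8) := by rw [mul_pow, hs6, hI6]; ring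
  show ((s * (Complex.I + 1)) ^ 4 + (s * (Complex.I - 1)) ^ 4).re < 0 ∧
    0 < ((s * Complex.I) ^ 4 + (s * Complex.I) ^ 4 + (1 : ℂ) ^ 4).re ∧
    0 < ((s * Complex.I) ^ 6 + (s * Complex.I) ^ 6 + (1 : ℂ) ^ 6).re ∧
    (Complex.I ^ 6 + s ^ 6 + s ^ 6).re < 0
  rw [e1, e2, e3, e4, hI6, hs6]
  norm_num
end TriageR11
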